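import Literature.Computability.AlgebraicComplexity.QuantumFunctionalsDirectSum
import Literature.Computability.AlgebraicComplexity.QuantumFunctionalsUpper
import HarnessLib

/-!
# Additivity of the quantum functional under `⊕` from the upper functional (CVZ Cor. 3.31)

Topic: `Literature/Computability/AlgebraicComplexity`; link file (no definitions) closing the
decomposition of the named fact `ChristandlVranaZuiddam2023_directSum` (`QuantumFunctionals.lean`;
Christandl–Vrana–Zuiddam, *Universal points in the asymptotic spectrum of tensors*,
J. Amer. Math. Soc. 36 (2023) = arXiv:1709.07851v3, Cor. 3.31: `F_θ(s ⊕ t) = F_θ(s) + F_θ(t)`).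

* `QuantumFunctionalsDirectSum.lean` proves the super-additive half (Thm. 3.19.2 = Lemma 3.22,
  `ChristandlVranaZuiddam2023_directSum_superadditive_holds`) and reduces the fact to its
  sub-additive half `ChristandlVranaZuiddam2023_directSum_subadditive`
  (`ChristandlVranaZuiddam2023_directSum_of_subadditive`, `…_iff_subadditive`).
* `QuantumFunctionalsUpper.lean` defines the upper quantum functional `F^θ` of Def. 3.3 and vendors
  the two printed results the sub-additive half rests on: Lemma 3.11
  (`ChristandlVranaZuiddam2023_upper_subadditive`: `F^θ(s ⊕ t) ≤ F^θ(s) + F^θ(t)`) and Thm. 3.30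
  (`ChristandlVranaZuiddam2023_upper_eq_lower`: `E^θ = E_θ` on `P_s(B) = P([3])`), with the
  pointwise consequence `quantumFunctional_directSumTensor_le_of_upper`.

Here the two are joined: `ChristandlVranaZuiddam2023_directSum_subadditive_of_upper` and
`ChristandlVranaZuiddam2023_directSum_of_upper` exhibit the tree's additivity fact as a consequence
of exactly Lemma 3.11 and Thm. 3.30, the route of the source (§3.4, "By the discussion at the
beginning of this section the following is immediate. Corollary 3.31").
-/

noncomputable section

namespace Literature.Computability.AlgebraicComplexity

universe u

/-- **Lemma 3.11 + Thm. 3.30 ⇒ the sub-additive half**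
`ChristandlVranaZuiddam2023_directSum_subadditive` of CVZ Cor. 3.31
(`F_θ(s ⊕ t) ≤ F_θ(s) + F_θ(t)` for `θ ∈ P([3])`).
[cite: ChristandlVranaZuiddam2023, Cor. 3.31] -/
theorem ChristandlVranaZuiddam2023_directSum_subadditive_of_upper
    (h₁ : ChristandlVranaZuiddam2023_upper_subadditive.{u})
    (h₂ : ChristandlVranaZuiddam2023_upper_eq_lower.{u}) :
    ChristandlVranaZuiddam2023_directSum_subadditive.{u} :=
  fun _θ hθ _ι _κ _μ _ι' _κ' _μ' _ _ _ _ _ _ _ _ _ _ _ _ s t =>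
    quantumFunctional_directSumTensor_le_of_upper h₁ h₂ hθ s t

/-- **Lemma 3.11 + Thm. 3.30 ⇒ additivity** `F_θ(s ⊕ t) = F_θ(s) + F_θ(t)` (CVZ Cor. 3.31), i.e. the
tree's named fact `ChristandlVranaZuiddam2023_directSum`, the super-additive half (Thm. 3.19.2)
being proved. [cite: ChristandlVranaZuiddam2023, Cor. 3.31] -/
theorem ChristandlVranaZuiddam2023_directSum_of_upper
    (h₁ : ChristandlVranaZuiddam2023_upper_subadditive.{u})
    (h₂ : ChristandlVranaZuiddam2023_upper_eq_lower.{u}) :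
    ChristandlVranaZuiddam2023_directSum.{u} :=
  ChristandlVranaZuiddam2023_directSum_of_subadditive
    (ChristandlVranaZuiddam2023_directSum_subadditive_of_upper h₁ h₂)

/-- The whole of CVZ Cor. 3.31 for `⊕` and `⊗` from the three upper-functional facts: additivity and
multiplicativity of `F_θ` follow from Lemma 3.11, Lemma 3.13 and Thm. 3.30.
[cite: ChristandlVranaZuiddam2023, Cor. 3.31] -/
theorem ChristandlVranaZuiddam2023_directSum_and_kronecker_of_upper
    (h₁ : ChristandlVranaZuiddam2023_upper_subadditive.{u})
    (h₂ : ChristandlVranaZuiddam2023_upper_submultiplicative.{u})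
    (h₃ : ChristandlVranaZuiddam2023_upper_eq_lower.{u}) :
    ChristandlVranaZuiddam2023_directSum.{u} ∧ ChristandlVranaZuiddam2023_kronecker.{u} :=
  ⟨ChristandlVranaZuiddam2023_directSum_of_upper h₁ h₃,
    ChristandlVranaZuiddam2023_kronecker_of_upper h₂ h₃⟩

end Literature.Computability.AlgebraicComplexity

end
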